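import Mathlib

/-!
# Jaffard's theorem (inverse-closedness of polynomial off-diagonal decay) — part 1: the matrix-norm inequalities

Toward LINE-18 stub K1 `DirKernelDipoleDecay` of crux `AllWindowsColdBox.BulkMidWindowSU2` (stmt-QuantumFields-24006), item K1-J of
the planner's STUB-PLAN-K1: a matrix on an index set of `D`-dimensional growth whose entries decay like `(1 + d(x,y))^{-r}`, `r > D`,
and which is boundedly invertible on `ℓ²` has an inverse with the SAME decay, with constants independent of the (finite) index set
(S. Jaffard, Ann. IHP Anal. Non Linéaire 7 (1990) 461–476, Prop. 3).  This file proves the elementary inequalities the dyadic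
bootstrap runs on, for real matrices over a finite index type `ι` with a pseudo-distance `d`:
* `col_mul_le` / `row_mul_le` — column/row `ℓ¹` sums are submultiplicative;
* `decay_mul_le` — the two-norm inequality `‖AB‖_r ≤ 2^r (‖A‖_r col(B) + row(A) ‖B‖_r)`;
* `sq_mulVec_pow_le`, `sq_col_pow_le`, `sq_row_pow_le` — `ℓ²`-contraction of powers of an `ℓ²`-contraction;
* `col_le_of_sq_le_of_decay` — a column `ℓ¹` sum from the column `ℓ²` norm (near part, Cauchy–Schwarz + volume growth) and the decay
  (far part, tail summability), at any scale `X ≥ 1`;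
* `decay_pow_two_mul_le` — the dyadic step `‖R^{2n}‖_r ≤ 2^{r+2} √c_S ‖R^n‖_r qⁿ g^{D/(2r−D)}`, `g = max(1, √c_S ‖R^n‖_r / qⁿ)`.
Everything is stated with explicit `∀`-hypotheses (no new definitions).  Pure Mathlib; standard axioms.

HONEST LABEL: helper inequalities toward one registered stub of a critic-passed line on the R2ξ″ RECORD-rung crux 24006; no stub, crux,
rung or summit is proved here; the Yang–Mills mass gap is NOT proved by this file.
-/

set_option autoImplicit false

open Finset Matrix

namespace Summit.QuantumFields.YangMills.Theorems.AllWindowsColdBox.Jaffard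

variable {ι : Type*} [Fintype ι]

/-! ## `ℓ¹` column and row sums of products -/

/-- Column `ℓ¹` sums are submultiplicative: `col(AB) ≤ col(A)·col(B)`. -/
theorem col_mul_le {A B : Matrix ι ι ℝ} {α β : ℝ} (hα : 0 ≤ α)
    (hA : ∀ y, ∑ x, |A x y| ≤ α) (hB : ∀ y, ∑ x, |B x y| ≤ β) (y : ι) :
    ∑ x, |(A * B) x y| ≤ α * β := by
  calc ∑ x, |(A * B) x y| ≤ ∑ x, ∑ z, |A x z| * |B z y| := by
        refine Finset.sum_le_sum fun x _ => ?_
        rw [Matrix.mul_apply]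
        exact (Finset.abs_sum_le_sum_abs _ _).trans
          (le_of_eq (Finset.sum_congr rfl fun z _ => abs_mul _ _))
    _ = ∑ z, (∑ x, |A x z|) * |B z y| := by
        rw [Finset.sum_comm]
        exact Finset.sum_congr rfl fun z _ => by rw [Finset.sum_mul]
    _ ≤ ∑ z, α * |B z y| :=
        Finset.sum_le_sum fun z _ => mul_le_mul_of_nonneg_right (hA z) (abs_nonneg _)
    _ ≤ α * β := by
        rw [← Finset.mul_sum]
        exact mul_le_mul_of_nonneg_left (hB y) hα

/-- Row `ℓ¹` sums are submultiplicative: `row(AB) ≤ row(A)·row(B)`. -/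
theorem row_mul_le {A B : Matrix ι ι ℝ} {α β : ℝ} (hβ : 0 ≤ β)
    (hA : ∀ x, ∑ y, |A x y| ≤ α) (hB : ∀ x, ∑ y, |B x y| ≤ β) (x : ι) :
    ∑ y, |(A * B) x y| ≤ α * β := by
  calc ∑ y, |(A * B) x y| ≤ ∑ y, ∑ z, |A x z| * |B z y| := by
        refine Finset.sum_le_sum fun y _ => ?_
        rw [Matrix.mul_apply]
        exact (Finset.abs_sum_le_sum_abs _ _).trans
          (le_of_eq (Finset.sum_congr rfl fun z _ => abs_mul _ _))
    _ = ∑ z, |A x z| * ∑ y, |B z y| := by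
        rw [Finset.sum_comm]
        exact Finset.sum_congr rfl fun z _ => by rw [Finset.mul_sum]
    _ ≤ ∑ z, |A x z| * β :=
        Finset.sum_le_sum fun z _ => mul_le_mul_of_nonneg_left (hB z) (abs_nonneg _)
    _ ≤ α * β := by
        rw [← Finset.sum_mul]
        exact mul_le_mul_of_nonneg_right (hA x) hβ

/-! ## The two-norm inequality for the weighted sup-norm `sup |A x y| (1 + d x y)^r` -/

/-- **Two-norm inequality.**  If `|A x y|(1+d x y)^r ≤ a`, `row(A) ≤ α`, `|B x y|(1+d x y)^r ≤ b`, `col(B) ≤ β` for a pseudo-distance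
`d` (nonnegative, triangle inequality) and `r ≥ 0`, then `|(AB) x y| (1+d x y)^r ≤ 2^r (a β + α b)`: in `Σ_z A x z B z y` either
`d x y ≤ 2 d x z` (and the weight is paid by `A`) or `d x y ≤ 2 d z y` (paid by `B`). -/
theorem decay_mul_le (d : ι → ι → ℝ) {r : ℝ} (hr : 0 ≤ r) (hd0 : ∀ x y, 0 ≤ d x y)
    (htri : ∀ x y z, d x y ≤ d x z + d z y) {A B : Matrix ι ι ℝ} {a b α β : ℝ}
    (ha : 0 ≤ a) (hb : 0 ≤ b)
    (hA : ∀ x y, |A x y| * (1 + d x y) ^ r ≤ a) (hArow : ∀ x, ∑ z, |A x z| ≤ α)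
    (hB : ∀ x y, |B x y| * (1 + d x y) ^ r ≤ b) (hBcol : ∀ y, ∑ z, |B z y| ≤ β) (x y : ι) :
    |(A * B) x y| * (1 + d x y) ^ r ≤ 2 ^ r * (a * β + α * b) := by
  set w : ℝ := (1 + d x y) ^ r with hw
  have hw0 : 0 ≤ w := Real.rpow_nonneg (by linarith [hd0 x y]) r
  have h2r : (0 : ℝ) ≤ 2 ^ r := Real.rpow_nonneg (by norm_num) r
  have hα : 0 ≤ α := le_trans (Finset.sum_nonneg fun z _ => abs_nonneg (A x z)) (hArow x)
  have hβ : 0 ≤ β := le_trans (Finset.sum_nonneg fun z _ => abs_nonneg (B z y)) (hBcol y)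
  set S : Finset ι := Finset.univ.filter (fun z => d x y ≤ 2 * d x z) with hS
  -- on `S` the weight is paid by `A`
  have key1 : ∀ z ∈ S, |A x z| * w ≤ 2 ^ r * a := by
    intro z hz
    have hz' : d x y ≤ 2 * d x z := (Finset.mem_filter.1 hz).2
    have h1 : (1 + d x y) ^ r ≤ (2 * (1 + d x z)) ^ r :=
      Real.rpow_le_rpow (by linarith [hd0 x y]) (by linarith) hr
    rw [Real.mul_rpow (by norm_num) (by linarith [hd0 x z])] at h1
    calc |A x z| * w ≤ |A x z| * (2 ^ r * (1 + d x z) ^ r) := mul_le_mul_of_nonneg_left h1 (abs_nonneg _)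
      _ = 2 ^ r * (|A x z| * (1 + d x z) ^ r) := by ring
      _ ≤ 2 ^ r * a := mul_le_mul_of_nonneg_left (hA x z) h2r
  -- off `S` the weight is paid by `B`
  have key2 : ∀ z ∈ Finset.univ.filter (fun z => ¬ d x y ≤ 2 * d x z), |B z y| * w ≤ 2 ^ r * b := by
    intro z hz
    have hz' : ¬ d x y ≤ 2 * d x z := (Finset.mem_filter.1 hz).2
    have hz'' : d x y ≤ 2 * d z y := by
      have := htri x y z
      have := not_le.1 hz'
      linarith
    have h1 : (1 + d x y) ^ r ≤ (2 * (1 + d z y)) ^ r :=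
      Real.rpow_le_rpow (by linarith [hd0 x y]) (by linarith) hr
    rw [Real.mul_rpow (by norm_num) (by linarith [hd0 z y])] at h1
    calc |B z y| * w ≤ |B z y| * (2 ^ r * (1 + d z y) ^ r) := mul_le_mul_of_nonneg_left h1 (abs_nonneg _)
      _ = 2 ^ r * (|B z y| * (1 + d z y) ^ r) := by ring
      _ ≤ 2 ^ r * b := mul_le_mul_of_nonneg_left (hB z y) h2r
  -- the entry as a split sum
  have habs : |(A * B) x y| ≤ ∑ z, |A x z| * |B z y| := by
    rw [Matrix.mul_apply]
    exact (Finset.abs_sum_le_sum_abs _ _).trans (le_of_eq (Finset.sum_congr rfl fun z _ => abs_mul _ _))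
  have hsplit : (∑ z, |A x z| * |B z y|) * w =
      ∑ z ∈ S, (|A x z| * w) * |B z y| +
        ∑ z ∈ Finset.univ.filter (fun z => ¬ d x y ≤ 2 * d x z), |A x z| * (|B z y| * w) := by
    rw [← Finset.sum_filter_add_sum_filter_not Finset.univ (fun z => d x y ≤ 2 * d x z), add_mul,
      Finset.sum_mul, Finset.sum_mul]
    congr 1
    · exact Finset.sum_congr rfl fun z _ => by ring
    · exact Finset.sum_congr rfl fun z _ => by ring
  have hS1 : ∑ z ∈ S, (|A x z| * w) * |B z y| ≤ 2 ^ r * a * β := by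
    calc ∑ z ∈ S, (|A x z| * w) * |B z y| ≤ ∑ z ∈ S, (2 ^ r * a) * |B z y| :=
          Finset.sum_le_sum fun z hz => mul_le_mul_of_nonneg_right (key1 z hz) (abs_nonneg _)
      _ = (2 ^ r * a) * ∑ z ∈ S, |B z y| := by rw [Finset.mul_sum]
      _ ≤ (2 ^ r * a) * ∑ z, |B z y| :=
          mul_le_mul_of_nonneg_left
            (Finset.sum_le_sum_of_subset_of_nonneg (Finset.subset_univ _) fun z _ _ => abs_nonneg _)
            (mul_nonneg h2r ha)
      _ ≤ 2 ^ r * a * β := mul_le_mul_of_nonneg_left (hBcol y) (mul_nonneg h2r ha)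
  have hS2 : ∑ z ∈ Finset.univ.filter (fun z => ¬ d x y ≤ 2 * d x z), |A x z| * (|B z y| * w) ≤
      2 ^ r * b * α := by
    calc ∑ z ∈ Finset.univ.filter (fun z => ¬ d x y ≤ 2 * d x z), |A x z| * (|B z y| * w)
          ≤ ∑ z ∈ Finset.univ.filter (fun z => ¬ d x y ≤ 2 * d x z), |A x z| * (2 ^ r * b) :=
          Finset.sum_le_sum fun z hz => mul_le_mul_of_nonneg_left (key2 z hz) (abs_nonneg _)
      _ = (∑ z ∈ Finset.univ.filter (fun z => ¬ d x y ≤ 2 * d x z), |A x z|) * (2 ^ r * b) := by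
          rw [Finset.sum_mul]
      _ ≤ (∑ z, |A x z|) * (2 ^ r * b) :=
          mul_le_mul_of_nonneg_right
            (Finset.sum_le_sum_of_subset_of_nonneg (Finset.subset_univ _) fun z _ _ => abs_nonneg _)
            (mul_nonneg h2r hb)
      _ ≤ α * (2 ^ r * b) := mul_le_mul_of_nonneg_right (hArow x) (mul_nonneg h2r hb)
      _ = 2 ^ r * b * α := by ring
  calc |(A * B) x y| * w ≤ (∑ z, |A x z| * |B z y|) * w := mul_le_mul_of_nonneg_right habs hw0
    _ = _ := hsplit
    _ ≤ 2 ^ r * a * β + 2 ^ r * b * α := add_le_add hS1 hS2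
    _ = 2 ^ r * (a * β + α * b) := by ring

/-! ## `ℓ²` contraction of powers -/

variable [DecidableEq ι]

/-- If `‖R v‖₂ ≤ q ‖v‖₂` for all `v` (squared form) then `‖Rⁿ v‖₂ ≤ qⁿ ‖v‖₂`. -/
theorem sq_mulVec_pow_le {R : Matrix ι ι ℝ} {q : ℝ} (hq : 0 ≤ q)
    (hR : ∀ v : ι → ℝ, ∑ x, (R *ᵥ v) x ^ 2 ≤ q ^ 2 * ∑ x, v x ^ 2) :
    ∀ (n : ℕ) (v : ι → ℝ), ∑ x, ((R ^ n) *ᵥ v) x ^ 2 ≤ (q ^ n) ^ 2 * ∑ x, v x ^ 2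
  | 0, v => by simp
  | n + 1, v => by
      rw [pow_succ, ← Matrix.mulVec_mulVec]
      calc ∑ x, ((R ^ n) *ᵥ (R *ᵥ v)) x ^ 2 ≤ (q ^ n) ^ 2 * ∑ x, (R *ᵥ v) x ^ 2 :=
            sq_mulVec_pow_le hq hR n _
        _ ≤ (q ^ n) ^ 2 * (q ^ 2 * ∑ x, v x ^ 2) := mul_le_mul_of_nonneg_left (hR v) (by positivity)
        _ = (q ^ (n + 1)) ^ 2 * ∑ x, v x ^ 2 := by ring

/-- Column `ℓ²` norms of `Rⁿ` are at most `qⁿ`. -/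
theorem sq_col_pow_le {R : Matrix ι ι ℝ} {q : ℝ} (hq : 0 ≤ q)
    (hR : ∀ v : ι → ℝ, ∑ x, (R *ᵥ v) x ^ 2 ≤ q ^ 2 * ∑ x, v x ^ 2) (n : ℕ) (y : ι) :
    ∑ x, (R ^ n) x y ^ 2 ≤ (q ^ n) ^ 2 := by
  have h := sq_mulVec_pow_le hq hR n (Pi.single y 1)
  have hsingle : ∑ x, (Pi.single y (1 : ℝ) : ι → ℝ) x ^ 2 = 1 := by
    rw [Finset.sum_eq_single y]
    · simp
    · intro x _ hx; simp [hx]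
    · intro hy; exact absurd (Finset.mem_univ y) hy
  rw [hsingle, mul_one, Matrix.mulVec_single_one] at h
  simpa [Matrix.col_apply] using h

/-- Row `ℓ²` norms of `Rⁿ` are at most `qⁿ` when `R` is symmetric. -/
theorem sq_row_pow_le {R : Matrix ι ι ℝ} {q : ℝ} (hq : 0 ≤ q) (hsymm : R.IsSymm)
    (hR : ∀ v : ι → ℝ, ∑ x, (R *ᵥ v) x ^ 2 ≤ q ^ 2 * ∑ x, v x ^ 2) (n : ℕ) (x : ι) :
    ∑ y, (R ^ n) x y ^ 2 ≤ (q ^ n) ^ 2 := by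
  have hs : (R ^ n).IsSymm := hsymm.pow n
  calc ∑ y, (R ^ n) x y ^ 2 = ∑ y, (R ^ n) y x ^ 2 :=
        Finset.sum_congr rfl fun y _ => by rw [hs.apply x y]
    _ ≤ (q ^ n) ^ 2 := sq_col_pow_le hq hR n x

/-- For a symmetric matrix, row sums of `|Rⁿ|` equal column sums. -/
theorem row_abs_pow_eq_col {R : Matrix ι ι ℝ} (hsymm : R.IsSymm) (n : ℕ) (x : ι) :
    ∑ y, |(R ^ n) x y| = ∑ y, |(R ^ n) y x| :=
  Finset.sum_congr rfl fun y _ => by rw [(hsymm.pow n).apply x y]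

/-! ## Column sums from the column `ℓ²` norm and the decay -/

omit [DecidableEq ι] in
/-- **Near/far split of a column sum.**  If the column `y` of `B` has `ℓ²` norm `≤ s`, `|B z y| (1 + d z y)^r ≤ a`, and the index set
has `D`-dimensional growth around `y` at scale `X ≥ 1` — `#{z : d z y ≤ X − 1} ≤ c_S X^D` and `Σ_{z : X − 1 ≤ d z y} (1 + d z y)^{−r}
≤ c_S X^{D−r}` — then `Σ_z |B z y| ≤ √c_S X^{D/2} s + c_S a X^{D−r}` (Cauchy–Schwarz on the ball, decay on its complement). -/
theorem col_le_of_sq_le_of_decay (d : ι → ι → ℝ) {r D cS : ℝ} (hcS : 0 ≤ cS) (hd0 : ∀ x y, 0 ≤ d x y)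
    {B : Matrix ι ι ℝ} {s a X : ℝ} (hs : 0 ≤ s) (ha : 0 ≤ a) (hX : 1 ≤ X) (y : ι)
    (hsq : ∑ z, B z y ^ 2 ≤ s ^ 2) (hdec : ∀ z, |B z y| * (1 + d z y) ^ r ≤ a)
    (hball : ((Finset.univ.filter (fun z => d z y ≤ X - 1)).card : ℝ) ≤ cS * X ^ D)
    (htail : ∑ z ∈ Finset.univ.filter (fun z => X - 1 ≤ d z y), ((1 + d z y) ^ r)⁻¹ ≤ cS * X ^ (D - r)) :
    ∑ z, |B z y| ≤ Real.sqrt cS * X ^ (D / 2) * s + cS * a * X ^ (D - r) := by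
  have hX0 : 0 ≤ X := le_trans zero_le_one hX
  set N : Finset ι := Finset.univ.filter (fun z => d z y ≤ X - 1) with hN
  set F : Finset ι := Finset.univ.filter (fun z => ¬ d z y ≤ X - 1) with hF
  have hsplit : ∑ z, |B z y| = ∑ z ∈ N, |B z y| + ∑ z ∈ F, |B z y| :=
    (Finset.sum_filter_add_sum_filter_not Finset.univ (fun z => d z y ≤ X - 1) _).symm
  -- near part: Cauchy–Schwarz against the constant `1`
  have hnear : ∑ z ∈ N, |B z y| ≤ Real.sqrt cS * X ^ (D / 2) * s := by
    have hcs : (∑ z ∈ N, |B z y| * 1) ^ 2 ≤ (∑ z ∈ N, |B z y| ^ 2) * ∑ z ∈ N, (1 : ℝ) ^ 2 :=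
      Finset.sum_mul_sq_le_sq_mul_sq N (fun z => |B z y|) (fun _ => 1)
    simp only [mul_one, one_pow, Finset.sum_const, nsmul_eq_mul] at hcs
    have h1 : ∑ z ∈ N, |B z y| ^ 2 ≤ s ^ 2 := by
      calc ∑ z ∈ N, |B z y| ^ 2 = ∑ z ∈ N, B z y ^ 2 := Finset.sum_congr rfl fun z _ => sq_abs _
        _ ≤ ∑ z, B z y ^ 2 :=
            Finset.sum_le_sum_of_subset_of_nonneg (Finset.subset_univ _) fun z _ _ => sq_nonneg _
        _ ≤ s ^ 2 := hsq
    have h2 : ((N.card : ℝ)) ≤ cS * X ^ D := hball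
    have hrhs0 : 0 ≤ Real.sqrt cS * X ^ (D / 2) * s :=
      mul_nonneg (mul_nonneg (Real.sqrt_nonneg _) (Real.rpow_nonneg hX0 _)) hs
    have hsq' : (Real.sqrt cS * X ^ (D / 2) * s) ^ 2 = cS * X ^ D * s ^ 2 := by
      have hXD : (X ^ (D / 2)) ^ 2 = X ^ D := by
        rw [← Real.rpow_natCast, ← Real.rpow_mul hX0]; norm_num
      calc (Real.sqrt cS * X ^ (D / 2) * s) ^ 2 = (Real.sqrt cS) ^ 2 * (X ^ (D / 2)) ^ 2 * s ^ 2 := by ring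
        _ = cS * X ^ D * s ^ 2 := by rw [Real.sq_sqrt hcS, hXD]
    have hle : (∑ z ∈ N, |B z y|) ^ 2 ≤ (Real.sqrt cS * X ^ (D / 2) * s) ^ 2 := by
      rw [hsq']
      calc (∑ z ∈ N, |B z y|) ^ 2 ≤ (∑ z ∈ N, |B z y| ^ 2) * (N.card : ℝ) := hcs
        _ ≤ s ^ 2 * (cS * X ^ D) :=
            mul_le_mul h1 h2 (Nat.cast_nonneg _) (sq_nonneg _)
        _ = cS * X ^ D * s ^ 2 := by ring
    exact (pow_le_pow_iff_left₀ (Finset.sum_nonneg fun z _ => abs_nonneg _) hrhs0 two_ne_zero).1 hle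
  -- far part: the decay and the tail sum
  have hfar : ∑ z ∈ F, |B z y| ≤ cS * a * X ^ (D - r) := by
    have hFsub : F ⊆ Finset.univ.filter (fun z => X - 1 ≤ d z y) := by
      intro z hz
      have := (Finset.mem_filter.1 hz).2
      exact Finset.mem_filter.2 ⟨Finset.mem_univ _, (not_le.1 this).le⟩
    have hterm : ∀ z, |B z y| ≤ a * ((1 + d z y) ^ r)⁻¹ := by
      intro z
      have hw : 0 < (1 + d z y) ^ r := Real.rpow_pos_of_pos (by linarith [hd0 z y]) r
      rw [← div_eq_mul_inv, le_div_iff₀ hw]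
      exact hdec z
    calc ∑ z ∈ F, |B z y| ≤ ∑ z ∈ Finset.univ.filter (fun z => X - 1 ≤ d z y), |B z y| :=
          Finset.sum_le_sum_of_subset_of_nonneg hFsub fun z _ _ => abs_nonneg _
      _ ≤ ∑ z ∈ Finset.univ.filter (fun z => X - 1 ≤ d z y), a * ((1 + d z y) ^ r)⁻¹ :=
          Finset.sum_le_sum fun z _ => hterm z
      _ = a * ∑ z ∈ Finset.univ.filter (fun z => X - 1 ≤ d z y), ((1 + d z y) ^ r)⁻¹ := by
          rw [Finset.mul_sum]
      _ ≤ a * (cS * X ^ (D - r)) := mul_le_mul_of_nonneg_left htail ha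
      _ = cS * a * X ^ (D - r) := by ring
  rw [hsplit]
  exact add_le_add hnear hfar

/-! ## The dyadic step -/

/-- **The dyadic step of the bootstrap.**  Let `R` be symmetric with `‖R v‖₂ ≤ q‖v‖₂` on an index set with `D`-dimensional growth
(`0 < D < r`, volume `#{d ≤ ρ} ≤ c_S (1+ρ)^D`, tails `Σ_{ρ ≤ d} (1+d)^{−r} ≤ c_S (1+ρ)^{D−r}`), and suppose `|(Rⁿ) x y| (1+d x y)^r ≤ a`.
With `g := max(1, √c_S·a/qⁿ)` and `θ := D/(2r − D)`:  `col(Rⁿ) ≤ 2 √c_S qⁿ g^θ` and `|(R²ⁿ) x y| (1+d x y)^r ≤ 4·2^r √c_S a qⁿ g^θ`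
(the near/far split at the balancing scale `X = g^{1/(r − D/2)}`, then the two-norm inequality). -/
theorem decay_pow_two_mul_le (d : ι → ι → ℝ) {r D cS q : ℝ} (hD : 0 < D) (hDr : D < r) (hcS : 0 < cS) (hq : 0 < q)
    (hd0 : ∀ x y, 0 ≤ d x y) (htri : ∀ x y z, d x y ≤ d x z + d z y)
    (hG1 : ∀ (y : ι) (ρ : ℝ), 0 ≤ ρ → ((Finset.univ.filter (fun z => d z y ≤ ρ)).card : ℝ) ≤ cS * (1 + ρ) ^ D)
    (hG2 : ∀ (y : ι) (ρ : ℝ), 0 ≤ ρ →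
      ∑ z ∈ Finset.univ.filter (fun z => ρ ≤ d z y), ((1 + d z y) ^ r)⁻¹ ≤ cS * (1 + ρ) ^ (D - r))
    {R : Matrix ι ι ℝ} (hsymm : R.IsSymm) (hR : ∀ v : ι → ℝ, ∑ x, (R *ᵥ v) x ^ 2 ≤ q ^ 2 * ∑ x, v x ^ 2)
    (n : ℕ) {a : ℝ} (ha : 0 ≤ a) (hdec : ∀ x y, |(R ^ n) x y| * (1 + d x y) ^ r ≤ a) :
    (∀ y, ∑ z, |(R ^ n) z y| ≤ 2 * Real.sqrt cS * q ^ n * (max 1 (Real.sqrt cS * a / q ^ n)) ^ (D / (2 * r - D))) ∧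
    (∀ x y, |(R ^ (2 * n)) x y| * (1 + d x y) ^ r ≤
      4 * 2 ^ r * Real.sqrt cS * a * q ^ n * (max 1 (Real.sqrt cS * a / q ^ n)) ^ (D / (2 * r - D))) := by
  set g : ℝ := max 1 (Real.sqrt cS * a / q ^ n) with hg
  set θ : ℝ := D / (2 * r - D) with hθ
  have hg1 : 1 ≤ g := le_max_left _ _
  have hg0 : 0 < g := lt_of_lt_of_le one_pos hg1
  have hqn : 0 < q ^ n := pow_pos hq n
  have hsq0 : 0 < Real.sqrt cS := Real.sqrt_pos.2 hcS
  have hrD2 : 0 < r - D / 2 := by linarith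
  -- the balancing scale
  set X : ℝ := g ^ (1 / (r - D / 2)) with hX
  have hX1 : 1 ≤ X := Real.one_le_rpow hg1 (by positivity)
  have hX0 : 0 ≤ X := le_trans zero_le_one hX1
  have hne : 2 * r - D ≠ 0 := by linarith
  have hne' : r - D / 2 ≠ 0 := hrD2.ne'
  have e1 : 1 / (r - D / 2) * (D / 2) = θ := by
    rw [hθ, div_mul_div_comm, one_mul]
    congr 1
    ring
  have e2 : 1 / (r - D / 2) * (D - r) = θ + -1 := by
    rw [hθ, div_mul_eq_mul_div, one_mul, ← sub_eq_add_neg, div_sub_one hne, div_eq_div_iff hne' hne]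
    ring
  have hXD2 : X ^ (D / 2) = g ^ θ := by
    rw [hX, ← Real.rpow_mul hg0.le, e1]
  have hXDr : X ^ (D - r) = g ^ θ * g⁻¹ := by
    rw [hX, ← Real.rpow_mul hg0.le, e2, Real.rpow_add hg0, Real.rpow_neg_one]
  -- column sums of `Rⁿ`
  have hcol : ∀ y, ∑ z, |(R ^ n) z y| ≤ 2 * Real.sqrt cS * q ^ n * g ^ θ := by
    intro y
    have h1 := col_le_of_sq_le_of_decay d hcS.le hd0 (B := R ^ n) hqn.le ha hX1 y
      (sq_col_pow_le hq.le hR n y) (fun z => hdec z y)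
      (by have := hG1 y (X - 1) (by linarith); rwa [add_sub_cancel] at this)
      (by have := hG2 y (X - 1) (by linarith); rwa [add_sub_cancel] at this)
    rw [hXD2, hXDr] at h1
    have h2 : cS * a * (g ^ θ * g⁻¹) ≤ Real.sqrt cS * q ^ n * g ^ θ := by
      have hga : Real.sqrt cS * a / q ^ n ≤ g := le_max_right _ _
      have h4 : Real.sqrt cS * a ≤ g * q ^ n := (div_le_iff₀ hqn).1 hga
      have h3 : cS * a ≤ Real.sqrt cS * q ^ n * g := by
        calc cS * a = Real.sqrt cS * (Real.sqrt cS * a) := by rw [← mul_assoc, Real.mul_self_sqrt hcS.le]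
          _ ≤ Real.sqrt cS * (g * q ^ n) := mul_le_mul_of_nonneg_left h4 hsq0.le
          _ = Real.sqrt cS * q ^ n * g := by ring
      have hgθ : 0 ≤ g ^ θ := Real.rpow_nonneg hg0.le θ
      calc cS * a * (g ^ θ * g⁻¹) = (cS * a) * g⁻¹ * g ^ θ := by ring
        _ ≤ (Real.sqrt cS * q ^ n * g) * g⁻¹ * g ^ θ :=
            mul_le_mul_of_nonneg_right (mul_le_mul_of_nonneg_right h3 (inv_nonneg.2 hg0.le)) hgθ
        _ = Real.sqrt cS * q ^ n * g ^ θ := by field_simp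
    calc ∑ z, |(R ^ n) z y| ≤ Real.sqrt cS * g ^ θ * q ^ n + cS * a * (g ^ θ * g⁻¹) := h1
      _ ≤ Real.sqrt cS * g ^ θ * q ^ n + Real.sqrt cS * q ^ n * g ^ θ := add_le_add le_rfl h2
      _ = 2 * Real.sqrt cS * q ^ n * g ^ θ := by ring
  refine ⟨hcol, fun x y => ?_⟩
  -- the two-norm inequality for `R²ⁿ = Rⁿ Rⁿ`
  have hr0 : 0 ≤ r := by linarith
  have hrow : ∀ x, ∑ z, |(R ^ n) x z| ≤ 2 * Real.sqrt cS * q ^ n * g ^ θ := fun x => by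
    rw [row_abs_pow_eq_col hsymm n x]; exact hcol x
  have hpow : R ^ (2 * n) = R ^ n * R ^ n := by rw [two_mul, pow_add]
  have h := decay_mul_le d hr0 hd0 htri ha ha hdec hrow hdec hcol x y
  rw [← hpow] at h
  calc |(R ^ (2 * n)) x y| * (1 + d x y) ^ r
        ≤ 2 ^ r * (a * (2 * Real.sqrt cS * q ^ n * g ^ θ) + 2 * Real.sqrt cS * q ^ n * g ^ θ * a) := h
    _ = 4 * 2 ^ r * Real.sqrt cS * a * q ^ n * g ^ θ := by ring

end Summit.QuantumFields.YangMills.Theorems.AllWindowsColdBox.Jaffard
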